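import Summits.BirchSwinnertonDyer.BirchSwinnertonDyer.Theorems.SchneiderFreeAdditiveX3GordTwoBranchIMCOfPT
import Summits.BirchSwinnertonDyer.BirchSwinnertonDyer.Theorems.SchneiderFreeAdditiveX3GordCellFiveLePerPair
import Summits.BirchSwinnertonDyer.BirchSwinnertonDyer.Theorems.SchneiderFreeAdditiveX3KrizLiLeafBernoulliThirtySeven
import HarnessLib

/-!
# Route `SchneiderFreeAdditiveX3` (K1 door): the PER-PAIR records — lower half, both halves from the twist-unit datum, Miller's `BSD(E, p)` — on the
# WHOLE (G-ord, `e = 2`) half at every odd prime, RE-TYPED GREENBERG-FREE (generation 33's F20 / generation 32's class-wide `p = 3` records)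

Cell `bsd-schneider-ideate`, seat `bsd-schneider-door-c5` (prover, generation 40; assembly layer; `--supports` 19177).  PARTITION: board row
B6 ∩ X3 ∩ sst-twist, `r = 1`, the WHOLE (G-ord, `e = 2`) half (2 560 of 7 101 census pairs: 2 411 at `p = 3`, 149 at `p ≥ 5`) of `Rank1Residual.partition`
— ASSEMBLY; types-the-object-of nothing new; RE-KEYS the per-pair records `KYBranchFiveLePerPair.*` (F20) and `KYBranchThreeAnomalousClass.missingLowerBoundAt_gordTwo_three`
/ `…missingPPartAt…` / `…bsdp…` off Greenberg's papers, on this generation's Greenberg-free columns (F38b, F40f) and F41's `corank_ge_ofPT`; closes none of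
B6's cells (BSD NOT advanced).  bears_on: K1-door (19177 r3; per-pair statements of the rung leaf and of `BSDp`).
* §1 `p = 3`: `missingLowerBoundAt_gordTwo_three` (lower half per pair on the whole cell: F40f's crux currency at the pair through generation 36's per-pair
  bridge `KrizLiLeafThirtySeven.missingLowerBoundAt_of_printedFacts_of_imcLowerInputAt`), `missingPPartAt_gordTwo_three_of_twistUnitAt`, `bsdp_gordTwo_three_of_twistUnitAt`.
* §2 `p ≥ 5`: `missingLowerBoundAt_gordTwo_five_le` (generation 33's per-datum proof — Heegner/twist datum with `d_K ≡ 1 (mod 8)`, the per-datum door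
  `KYBranchFiveLeOfCGLS.additiveIMCLowerBDPOnTree_subGordTwo_five_le_offSliver` of F38b, control, Kolyvagin, `JointLowerManin`, `PartnerUpperRankZero` — no
  sliver, no Mazur), `missingPPartAt_gordTwo_five_le_of_twistUnitAt`, `bsdp_gordTwo_five_le_of_twistUnitAt`.
* §3 every odd `p`: `missingLowerBoundAt_gordTwo`, `missingPPartAt_gordTwo_of_twistUnitAt`, `bsdp_gordTwo_of_twistUnitAt`.
INPUT LEDGER per pair (lower half): `PrintedFacts` ∪ {Hsieh A, LZZ, Castella–Hsieh signed} ∪ {[DIV.dvd] PRE; [AN3] (both forms), [AN-BR₅] PRE; [BR3]; CGLS Thm 2.1.2}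
∪ {CGLS Prop 1.2.5 (module clause), Prop 14, Cor 1.2.6 ×2; [RH], [PWL-θ]; Rubin 4.1; Katz II.6.4; Hida Thm I} ∪ {Milne ADT I Thm. 4.10 (a) `hPT`} — NO Greenberg;
both halves add the pair's twist-unit datum `Upper.TwistUnitFieldOffSliverAt W p` (census: a kit certificate per pair; class-wide: wing r2, OPEN).
HONEST FRAMING: compositions of tree theorems, CONDITIONAL BY NAME on the displayed statements; `BSDp W p` here is BSD_p MODULO those statements and the
pair's TU datum — NOT a proof of BSD for any curve; no definition, no named fact, no `sorry`; nothing is closed; «closes rung: none».  References: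
[KellerYin2024b] Thm. 3.3.6, Prop. 3.4.4, §3.5, Thm. 3.5.1, Lemma 2.3.8; [KellerYin2024] Thms. 1.2.2, 1.4.1, Prop. 1.2.5; [CastellaGrossiLeeSkinner2022] Thms. 1.2.2,
2.1.2, 2.2.2, Props. 1.2.5, 14, Cor. 1.2.6; [MilneADT2006] I Thm. 4.10 (a); [Miller2011LMS] Def. 1.1; [JetchevSkinnerWan2017] §7.4.1; [FriedbergHoffstein1995] Thm. B;
[GrossZagier1986] I.(6.3), (7.3); this seat p732334 (F20), p72xxxx (gen 32), F38b, F40f, F41.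
-/

set_option autoImplicit false
set_option linter.dupNamespace false -- the summit namespace `…BirchSwinnertonDyer.BirchSwinnertonDyer.Theorems` (Sub = Summit, D-0017) trips it

noncomputable section

open scoped Classical NumberField

open Field NumberField IsDedekindDomain WeierstrassCurve PowerSeries
  Literature.NumberTheory.EllipticCurves Literature.NumberTheory.EllipticCurves.GreenbergSelmer
  Literature.NumberTheory.GaloisRepresentations Literature.NumberTheory.GaloisCohomology
  Literature.NumberTheory.EllipticCurves.ModularForms Literature.NumberTheory.EllipticCurves.Rank1Residual
  Literature.NumberTheory.EllipticCurves.Rank1Residual.Typed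
  Literature.NumberTheory.EllipticCurves.KellerYin2024 Literature.NumberTheory.EllipticCurves.CaiShuTian2014
  Literature.NumberTheory.IwasawaTheory Literature.NumberTheory.IwasawaTheory.Greenberg2016
  Literature.NumberTheory.IwasawaTheory.Greenberg2006
  Literature.NumberTheory.EllipticCurves.Rubin1991 Literature.NumberTheory.EllipticCurves.DeShalit1987
  Literature.NumberTheory.EllipticCurves.Hida2010MuInvariant Literature.NumberTheory.EllipticCurves.BCGKPST2020
  Summit.BirchSwinnertonDyer.Rank1Residual Summit.BirchSwinnertonDyer.Rank1Residual.X11b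
  Summit.BirchSwinnertonDyer.Rank1Residual.X11b.AcSelmer Summit.BirchSwinnertonDyer.Rank1Residual.X11b.Halves
  Summit.BirchSwinnertonDyer.Rank1Residual.Additive Summit.BirchSwinnertonDyer.Rank1Residual.GaloisImage
  Summit.BirchSwinnertonDyer.BirchSwinnertonDyer.Theorems
  Summit.BirchSwinnertonDyer.BirchSwinnertonDyer.Theorems.EisensteinPrimesMuLambda
  Summit.BirchSwinnertonDyer.BirchSwinnertonDyer.Theorems.SchneiderFree
  Summit.BirchSwinnertonDyer.BirchSwinnertonDyer.Theorems.SchneiderFree.Upper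
  Summit.BirchSwinnertonDyer.BirchSwinnertonDyer.Theorems.SchneiderFree.KYRead
  Summit.BirchSwinnertonDyer.BirchSwinnertonDyer.Theses.SchneiderFreeAdditiveX3
  Summit.BirchSwinnertonDyer.BirchSwinnertonDyer.Theorems.SchneiderFreeAdditiveX3.ControlDischarged
  Summit.BirchSwinnertonDyer.BirchSwinnertonDyer.Theorems.SchneiderFreeAdditiveX3.KYBranchOnly
  Summit.BirchSwinnertonDyer.BirchSwinnertonDyer.Theorems.SchneiderFreeAdditiveX3.UpperOfPrintDvd
  Summit.BirchSwinnertonDyer.BirchSwinnertonDyer.Theorems.SchneiderFreeAdditiveX3.UpperThreeAnomalousOfPartnerClass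
  Summit.BirchSwinnertonDyer.BirchSwinnertonDyer.Theorems.SchneiderFreeAdditiveX3.KYBranchAnacongOfPT
open Literature.NumberTheory.EllipticCurves.CastellaGrossiLeeSkinner2022
  (prop14_residualCharacterSelmer_finite thm212_exists_isKatzLFunction prop125_characterGrSelmerDual_torsion_muZero_dim prop125_characterGrSelmerDual_corank_ge
    cor126_residualCharacter_globalLift cor126_residualCharacter_localSurjective)
open Literature.NumberTheory.EllipticCurves.KellerYin2024 (thm122_rubinHida_residualPair_unrSelmer prop125_residualPair_unrSelmer_imprimitive
  thm351_anacong_branch_three_allTwists thm351_anacong_charLambda_branch_five_le)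

namespace Summit.BirchSwinnertonDyer.BirchSwinnertonDyer.Theorems.SchneiderFreeAdditiveX3.KYBranchPerPairOfPT

/-! ### §1 `p = 3`: the per-pair records on the whole (G-ord, `e = 2`) cell, Greenberg-free -/

/-- **LOWER half per pair on the WHOLE (G-ord, `e = 2`) cell AT `p = 3`, no per-pair hypothesis, Greenberg-free:** for every globally minimal `W/ℚ` with
`r_an = 1`, `ClassX3 W 3`, `SubGordTwo W 3`: `MissingLowerBoundAt W 3` (`ord₃ #Ш(E)_an ≤ ord₃ #Ш(E)`) — F40f's crux currency at the pair
(`KYBranchThreeAnomalousClassCurrencyOfPT.additiveIMCLowerBDPInputManinAt_gordTwo_three`, NAT ∪ anomalous, class-wide) through the per-pair bridge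
`KrizLiLeafThirtySeven.missingLowerBoundAt_of_printedFacts_of_imcLowerInputAt` (control CLOSED + Kolyvagin, STEP L, Gross–Zagier bookkeeping, partner's upper half).
CONDITIONAL on the displayed named statements; closes no item; BSD not advanced. [claim: KellerYin2024PotOrd, status: under-review]
[cite: KellerYin2024b, Thm. 3.3.6, Prop. 3.4.4, Thm. 3.5.1 (arXiv:2410.23241 pp. 19–20) (preprint; hypotheses)]
[cite: CastellaGrossiLeeSkinner2022, Thms. 1.2.2, 2.1.2, 2.2.2, Props. 1.2.5, 14, Cor. 1.2.6] [cite: KellerYin2024, Thms. 1.2.2, 1.4.1, Prop. 1.2.5 (arXiv:2402.12781v2)]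
[cite: MilneADT2006, I Thm. 4.10 (a)] [cite: JetchevSkinnerWan2017, §7.4.1 (arXiv:1512.06894 p. 30)] -/
theorem missingLowerBoundAt_gordTwo_three (hF : PrintedFacts)
    (hA : Hsieh2014.thmA_exists_isHsiehLFunction_unrPeriod_anyLevel)
    (hL : LiuZhangZhang2018.thm151_thm153_modularCurve_heegnerVector_additive)
    (hCHσ : castellaHsieh2018_exists_isBranchBDPLFunction_signed)
    (hDVD : thm336_dvd_branch_OPEN) (hAN3 : thm351_anacong_branch_three) (hAN : thm351_anacong_branch_three_allTwists)
    (hBR : thm122_charLambda_pair_three) (h212 : thm212_exists_isKatzLFunction)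
    (hprop125 : prop125_characterGrSelmerDual_torsion_muZero_dim) (hfact : prop14_residualCharacterSelmer_finite)
    (hlift : cor126_residualCharacter_globalLift) (hlocal : cor126_residualCharacter_localSurjective)
    (hRH : thm122_rubinHida_residualPair_unrSelmer) (hPWL : prop125_residualPair_unrSelmer_imprimitive)
    (h331 : thm331_rubin_exists_katzMeasure₂_pseudoIso_span_eq)
    (hFE : thmII64_katzMeasure₂_functionalEquation) (hO1 : thmI_mu_katzBranch_reflect_eq_zero)
    (hPT : ∀ (L : Type) [Field L] [NumberField L] [IsTotallyComplex L] (S : Set (HeightOneSpectrum (𝓞 L))),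
      S.Finite → Literature.NumberTheory.GaloisCohomology.poitouTate_shaRestricted_tateDual_natural_at L S) :
    ∀ (W : WeierstrassCurve ℚ) [W.IsElliptic] [W.IsGloballyMinimal],
      W.analyticRank = 1 → ClassX3 W 3 → Additive.SubGordTwo W 3 → MissingLowerBoundAt W 3 :=
  fun W _ _ hr hX hG =>
    KrizLiLeafThirtySeven.missingLowerBoundAt_of_printedFacts_of_imcLowerInputAt hF W 3 hr (by decide) hX (Or.inr hG)
      (KYBranchThreeAnomalousClassCurrencyOfPT.additiveIMCLowerBDPInputManinAt_gordTwo_three hF.2.1 hF.2.2.2.2.1 hA hL hCHσ hDVD hAN3 hAN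
        hBR h212 hprop125 hfact hlift hlocal hRH hPWL h331 hFE hO1 hPT W hr hX hG)

/-- **BOTH halves per pair on the whole (G-ord, `e = 2`) cell AT `p = 3` from the TU datum: `MissingPPartAt W 3`, Greenberg-free** — §1's lower half and
generation 29's cell-wide upper half (`missingUpperBoundAt_gordTwo_three_…_of_RH_of_PWL_of_castellaHsieh_signed`, ⟸ PUB ∪ {[DIV.dvd], CGLS Prop. 14, [RH], [PWL-θ]}
∪ {TU}).  CONDITIONAL; closes no item; BSD not advanced. [claim: KellerYin2024PotOrd, status: under-review] [cite: Miller2011LMS, Def. 1.1]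
[cite: KellerYin2024b, Thm. 3.3.6 and Prop. 3.4.4 (arXiv:2410.23241 p. 19) (preprint; hypothesis)] [cite: CastellaGrossiLeeSkinner2022, Thms. 1.2.2, 2.1.2, 2.2.2, Prop. 14] -/
theorem missingPPartAt_gordTwo_three_of_twistUnitAt (hF : PrintedFacts)
    (hA : Hsieh2014.thmA_exists_isHsiehLFunction_unrPeriod_anyLevel)
    (hL : LiuZhangZhang2018.thm151_thm153_modularCurve_heegnerVector_additive)
    (hCHσ : castellaHsieh2018_exists_isBranchBDPLFunction_signed)
    (hDVD : thm336_dvd_branch_OPEN) (hAN3 : thm351_anacong_branch_three) (hAN : thm351_anacong_branch_three_allTwists)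
    (hBR : thm122_charLambda_pair_three) (h212 : thm212_exists_isKatzLFunction)
    (hprop125 : prop125_characterGrSelmerDual_torsion_muZero_dim) (hfact : prop14_residualCharacterSelmer_finite)
    (hlift : cor126_residualCharacter_globalLift) (hlocal : cor126_residualCharacter_localSurjective)
    (hRH : thm122_rubinHida_residualPair_unrSelmer) (hPWL : prop125_residualPair_unrSelmer_imprimitive)
    (h331 : thm331_rubin_exists_katzMeasure₂_pseudoIso_span_eq)
    (hFE : thmII64_katzMeasure₂_functionalEquation) (hO1 : thmI_mu_katzBranch_reflect_eq_zero)
    (hPT : ∀ (L : Type) [Field L] [NumberField L] [IsTotallyComplex L] (S : Set (HeightOneSpectrum (𝓞 L))),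
      S.Finite → Literature.NumberTheory.GaloisCohomology.poitouTate_shaRestricted_tateDual_natural_at L S) :
    ∀ (W : WeierstrassCurve ℚ) [W.IsElliptic] [W.IsGloballyMinimal],
      W.analyticRank = 1 → ClassX3 W 3 → Additive.SubGordTwo W 3 → Upper.TwistUnitFieldOffSliverAt W 3 → MissingPPartAt W 3 :=
  fun W _ _ hr hX hG hTU =>
    missingPPartAt_of_lower_of_upper W 3
      (missingLowerBoundAt_gordTwo_three hF hA hL hCHσ hDVD hAN3 hAN hBR h212 hprop125 hfact hlift hlocal hRH hPWL h331 hFE hO1 hPT W hr hX hG)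
      (missingUpperBoundAt_gordTwo_three_of_printedFacts_of_twistUnitAt_of_hsieh_of_lzz_of_KY_dvd_of_prop14_of_RH_of_PWL_of_castellaHsieh_signed
        hF hA hL hDVD hfact hCHσ hRH hPWL W hr hX hG hTU)

/-- **Miller's `BSD(E, 3)` per pair on the WHOLE (G-ord, `e = 2`) cell from the TU datum, Greenberg-free** — the previous theorem through `bsdp_of_missingPPartAt`
(rank = analytic rank and `Ш` finite by GZK).  NOT a proof of BSD for any curve: BSD₃ MODULO {published theorems} ∪ {[DIV.dvd] (preprint), the analytic counts,
[RH], [PWL-θ], Milne I 4.10 (a)} ∪ {the pair's TU certificate}. [claim: KellerYin2024PotOrd, status: under-review] [cite: Miller2011LMS, §1 and Def. 1.1]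
[cite: KellerYin2024b, Thm. 3.3.6 and Prop. 3.4.4 (arXiv:2410.23241 p. 19) (preprint; hypothesis)] -/
theorem bsdp_gordTwo_three_of_twistUnitAt (hF : PrintedFacts)
    (hA : Hsieh2014.thmA_exists_isHsiehLFunction_unrPeriod_anyLevel)
    (hL : LiuZhangZhang2018.thm151_thm153_modularCurve_heegnerVector_additive)
    (hCHσ : castellaHsieh2018_exists_isBranchBDPLFunction_signed)
    (hDVD : thm336_dvd_branch_OPEN) (hAN3 : thm351_anacong_branch_three) (hAN : thm351_anacong_branch_three_allTwists)
    (hBR : thm122_charLambda_pair_three) (h212 : thm212_exists_isKatzLFunction)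
    (hprop125 : prop125_characterGrSelmerDual_torsion_muZero_dim) (hfact : prop14_residualCharacterSelmer_finite)
    (hlift : cor126_residualCharacter_globalLift) (hlocal : cor126_residualCharacter_localSurjective)
    (hRH : thm122_rubinHida_residualPair_unrSelmer) (hPWL : prop125_residualPair_unrSelmer_imprimitive)
    (h331 : thm331_rubin_exists_katzMeasure₂_pseudoIso_span_eq)
    (hFE : thmII64_katzMeasure₂_functionalEquation) (hO1 : thmI_mu_katzBranch_reflect_eq_zero)
    (hPT : ∀ (L : Type) [Field L] [NumberField L] [IsTotallyComplex L] (S : Set (HeightOneSpectrum (𝓞 L))),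
      S.Finite → Literature.NumberTheory.GaloisCohomology.poitouTate_shaRestricted_tateDual_natural_at L S) :
    ∀ (W : WeierstrassCurve ℚ) [W.IsElliptic] [W.IsGloballyMinimal],
      W.analyticRank = 1 → ClassX3 W 3 → Additive.SubGordTwo W 3 → Upper.TwistUnitFieldOffSliverAt W 3 → BSDp W 3 :=
  fun W _ _ hr hX hG hTU =>
    bsdp_of_missingPPartAt W 3 hF.2.2.1 (le_of_eq hr)
      (missingPPartAt_gordTwo_three_of_twistUnitAt hF hA hL hCHσ hDVD hAN3 hAN hBR h212 hprop125 hfact hlift hlocal hRH hPWL h331 hFE hO1 hPT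
        W hr hX hG hTU)

/-! ### §2 `p ≥ 5`: the per-pair records, Greenberg-free (no sliver, no Mazur) -/

/-- **LOWER half per pair on the (G-ord, `e = 2`) cell AT `p ≥ 5` ⇐ `PrintedFacts` ∧ Hsieh A ∧ LZZ ∧ Castella–Hsieh signed ∧ [DIV.dvd] ∧ [AN-BR₅] ∧ CGLS Prop 1.2.5
(module clause), Prop 14, Cor 1.2.6 ×2 ∧ Milne ADT I Thm. 4.10 (a) — NO crux, NO per-pair hypothesis, NO sliver, NO Greenberg** — generation 33's F20 §1 proof
(the Heegner/twist datum with `d_K ≡ 1 (mod 8)`, STEP L at it from F38b's per-datum door `KYBranchFiveLeOfCGLS.additiveIMCLowerBDPOnTree_subGordTwo_five_le_offSliver`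
+ the control inequality (CLOSED corner + Kolyvagin), `Ш(E/K)` finite by Kolyvagin, `JointLowerManin` / `PartnerUpperRankZero`), the CGLS corank clause fed by
F41's `corank_ge_ofPT`.  CONDITIONAL; closes no item; BSD not advanced. [claim: KellerYin2024PotOrd, status: under-review]
[cite: KellerYin2024b, Thm. 3.3.6, Prop. 3.4.4, §3.5, Thm. 3.5.1 and Lemma 2.3.8 (arXiv:2410.23241 pp. 11, 19–20) (preprint; hypotheses)]
[cite: CastellaGrossiLeeSkinner2022, Thm. 1.2.2, Props. 1.2.5, 14, Cor. 1.2.6] [cite: MilneADT2006, I Thm. 4.10 (a)] [cite: JetchevSkinnerWan2017, §7.4.1]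
[cite: FriedbergHoffstein1995, Thm. B] [cite: GrossZagier1986, Thm. I.(6.3) and (7.3)] -/
theorem missingLowerBoundAt_gordTwo_five_le (hF : PrintedFacts)
    (hA : Hsieh2014.thmA_exists_isHsiehLFunction_unrPeriod_anyLevel)
    (hL : LiuZhangZhang2018.thm151_thm153_modularCurve_heegnerVector_additive)
    (hCHσ : castellaHsieh2018_exists_isBranchBDPLFunction_signed)
    (hDVD : thm336_dvd_branch_OPEN) (hAN : thm351_anacong_charLambda_branch_five_le)
    (hprop125 : prop125_characterGrSelmerDual_torsion_muZero_dim) (hfact : prop14_residualCharacterSelmer_finite)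
    (hlift : cor126_residualCharacter_globalLift) (hlocal : cor126_residualCharacter_localSurjective)
    (hPT : ∀ (L : Type) [Field L] [NumberField L] [IsTotallyComplex L] (S : Set (HeightOneSpectrum (𝓞 L))),
      S.Finite → Literature.NumberTheory.GaloisCohomology.poitouTate_shaRestricted_tateDual_natural_at L S) :
    ∀ (W : WeierstrassCurve ℚ) [W.IsElliptic] [W.IsGloballyMinimal] (p : ℕ) [Fact p.Prime],
      5 ≤ p → W.analyticRank = 1 → ClassX3 W p → Additive.SubGordTwo W p → MissingLowerBoundAt W p := by
  have hJ : JointLowerManin := schneiderFreeAdditiveX3_jointLowerManin_proof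
  have hU : PartnerUpperRankZero := schneiderFreeAdditiveX3_partnerUpperRankZero_proof
  have hge : prop125_characterGrSelmerDual_corank_ge := KYBranchAnacongOfPT.corank_ge_ofPT hPT hprop125
  obtain ⟨hGZ, hKo, hGZK, hmod, hmodD, hCas, hGZ73, hFH, hpar, hHP, hDel, hW16, hWu⟩ := hF
  intro W _ _ p _ hp5 hr hX hG
  have hp2 : p ≠ 2 := by omega
  have hS : Additive.SubSemistableTwist W p := Or.inr hG
  obtain ⟨N, _, K, _, _, Dt, H, ι, P, Wd, _, _, hN, hKiq, hodd, hunit, hHe, hLtw, hP, hnt, hWd, hrd, hXd, hSd, h8⟩ :=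
    exists_heegnerTwistDataManin_discr_emod_eight hFH hpar hHP hGZ hmod W p hr hp2 hX hS
  have hdK : NumberField.discr K ≠ -3 := discr_ne_neg_three_of_emod_eight h8
  have hloc : Additive.N10.Locus W p :=
    (Additive.N10.locus_iff_cells W p).mpr
      ((Additive.N10.cellM_or_cellGordTwo_of_classX3_of_subSemistableTwist W p hp2 hX hS).elim Or.inl
        (fun h ↦ Or.inr (Or.inl h)))
  have hfin : (W.baseChange K).ShaFinite := (hKo N W K hKiq hHe ⟨Dt, H, ι, hP⟩ hnt).2
  have hidx : IndexLowerBoundLeAt W p K P (padicValNat p Dt.c.natAbs) := by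
    refine indexLowerBoundLeAt_of_frames_of_shaFinite_le hloc hN hKiq hHe hfin ?_ ?_
    · intro κ hκ γ _ 𝔭 h𝔭 he hf
      exact KYBranchFiveLeOfCGLS.additiveIMCLowerBDPOnTree_subGordTwo_five_le_offSliver hKo hmodD hA hL hCHσ hDVD hAN hprop125 hge hfact hlift
        hlocal hPT hp5 W hr hX hG N K Dt H ι P hr hloc hN hKiq hodd hunit hHe hLtw hP hnt hdK κ hκ γ 𝔭 h𝔭 he hf
    · intro κ hκ γ _ 𝔭 h𝔭 he hf
      exact additiveControlLeOnTreeAt_of_pt_of_kolyvagin pt_selmer_forall hKo W p hr hp2 hX hS N K Dt H ι P hr hloc hN hKiq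
        hodd hunit hHe hLtw hP hnt κ hκ γ 𝔭 h𝔭 he hf
  have hJ' : JointLowerBoundAt W Wd p :=
    hJ hGZ hKo hGZK hmod hmodD hCas hGZ73 W p N K Dt H ι P Wd hr hN hKiq hodd hunit hHe hLtw hP hnt hWd hrd hp2 hidx
  exact missingLowerBoundAt_of_joint_of_upper hJ' (hU hDel hGZK hmod hmodD hW16 hWu Wd p hrd hp2 hXd hSd)

/-- **BOTH halves per pair on the (G-ord, `e = 2`) cell AT `p ≥ 5`: `MissingPPartAt W p` ⇐ §2's inputs ∧ the pair's twist-unit datum, Greenberg-free** — §2 (lower)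
and generation 23's `UpperOfPrintDvd.missingUpperBoundAt_gordTwo_fiveLe_…` (upper, ⟸ PUB ∪ {[DIV.dvd]} ∪ {TU}).  CONDITIONAL; closes no item; BSD not advanced.
[claim: KellerYin2024PotOrd, status: under-review] [cite: Miller2011LMS, Def. 1.1]
[cite: KellerYin2024b, Thm. 3.3.6, Prop. 3.4.4 and §3.5 (arXiv:2410.23241 pp. 19–20) (preprint; hypotheses)] [cite: CastellaGrossiLeeSkinner2022, Thm. 1.2.2, Props. 1.2.5, 14, Cor. 1.2.6] -/
theorem missingPPartAt_gordTwo_five_le_of_twistUnitAt (hF : PrintedFacts)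
    (hA : Hsieh2014.thmA_exists_isHsiehLFunction_unrPeriod_anyLevel)
    (hL : LiuZhangZhang2018.thm151_thm153_modularCurve_heegnerVector_additive)
    (hCHσ : castellaHsieh2018_exists_isBranchBDPLFunction_signed)
    (hDVD : thm336_dvd_branch_OPEN) (hAN : thm351_anacong_charLambda_branch_five_le)
    (hprop125 : prop125_characterGrSelmerDual_torsion_muZero_dim) (hfact : prop14_residualCharacterSelmer_finite)
    (hlift : cor126_residualCharacter_globalLift) (hlocal : cor126_residualCharacter_localSurjective)
    (hPT : ∀ (L : Type) [Field L] [NumberField L] [IsTotallyComplex L] (S : Set (HeightOneSpectrum (𝓞 L))),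
      S.Finite → Literature.NumberTheory.GaloisCohomology.poitouTate_shaRestricted_tateDual_natural_at L S) :
    ∀ (W : WeierstrassCurve ℚ) [W.IsElliptic] [W.IsGloballyMinimal] (p : ℕ) [Fact p.Prime],
      5 ≤ p → W.analyticRank = 1 → ClassX3 W p → Additive.SubGordTwo W p → Upper.TwistUnitFieldOffSliverAt W p → MissingPPartAt W p :=
  fun W _ _ p _ hp5 hr hX hG hTU =>
    missingPPartAt_of_lower_of_upper W p
      (missingLowerBoundAt_gordTwo_five_le hF hA hL hCHσ hDVD hAN hprop125 hfact hlift hlocal hPT W p hp5 hr hX hG)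
      (missingUpperBoundAt_gordTwo_fiveLe_of_printedFacts_of_twistUnitAt_of_hsieh_of_lzz_of_KY_dvd_of_prop14_of_castellaHsieh_signed hF hA hL
        hDVD hfact hCHσ W p hp5 hr hX hG hTU)

/-- **Miller's `BSD(E, p)` per pair on the (G-ord, `e = 2`) cell AT `p ≥ 5` from the TU datum, Greenberg-free** — through `bsdp_of_missingPPartAt`.  NOT a proof of
BSD for any curve: BSD_p MODULO {published theorems} ∪ {[DIV.dvd], [AN-BR₅] (preprint), Milne I 4.10 (a)} ∪ {the pair's TU certificate}.
[claim: KellerYin2024PotOrd, status: under-review] [cite: Miller2011LMS, §1 and Def. 1.1]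
[cite: KellerYin2024b, Thm. 3.3.6, Prop. 3.4.4 and §3.5 (arXiv:2410.23241 pp. 19–20) (preprint; hypotheses)] -/
theorem bsdp_gordTwo_five_le_of_twistUnitAt (hF : PrintedFacts)
    (hA : Hsieh2014.thmA_exists_isHsiehLFunction_unrPeriod_anyLevel)
    (hL : LiuZhangZhang2018.thm151_thm153_modularCurve_heegnerVector_additive)
    (hCHσ : castellaHsieh2018_exists_isBranchBDPLFunction_signed)
    (hDVD : thm336_dvd_branch_OPEN) (hAN : thm351_anacong_charLambda_branch_five_le)
    (hprop125 : prop125_characterGrSelmerDual_torsion_muZero_dim) (hfact : prop14_residualCharacterSelmer_finite)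
    (hlift : cor126_residualCharacter_globalLift) (hlocal : cor126_residualCharacter_localSurjective)
    (hPT : ∀ (L : Type) [Field L] [NumberField L] [IsTotallyComplex L] (S : Set (HeightOneSpectrum (𝓞 L))),
      S.Finite → Literature.NumberTheory.GaloisCohomology.poitouTate_shaRestricted_tateDual_natural_at L S) :
    ∀ (W : WeierstrassCurve ℚ) [W.IsElliptic] [W.IsGloballyMinimal] (p : ℕ) [Fact p.Prime],
      5 ≤ p → W.analyticRank = 1 → ClassX3 W p → Additive.SubGordTwo W p → Upper.TwistUnitFieldOffSliverAt W p → BSDp W p :=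
  fun W _ _ p _ hp5 hr hX hG hTU =>
    bsdp_of_missingPPartAt W p hF.2.2.1 (le_of_eq hr)
      (missingPPartAt_gordTwo_five_le_of_twistUnitAt hF hA hL hCHσ hDVD hAN hprop125 hfact hlift hlocal hPT W p hp5 hr hX hG hTU)

/-! ### §3 The WHOLE (G-ord, `e = 2`) half at EVERY odd prime, Greenberg-free -/

/-- **The LOWER half `ord_p #Ш(E)_an ≤ ord_p #Ш(E)` PER PAIR on the WHOLE (G-ord, `e = 2`) half of B6 ∩ X3 at EVERY odd prime `p`, NO per-pair hypothesis,
Greenberg-free** — `p = 3` is §1, `p ≥ 5` is §2.  CONDITIONAL on every displayed hypothesis; closes no item; BSD not advanced beyond this typed reduction.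
[claim: KellerYin2024PotOrd, status: under-review] [cite: KellerYin2024b, Thm. 3.3.6, Prop. 3.4.4, §3.5, Thm. 3.5.1 and Lemma 2.3.8 (arXiv:2410.23241 pp. 11, 19–20) (preprint; hypotheses)]
[cite: CastellaGrossiLeeSkinner2022, Thms. 1.2.2, 2.1.2, 2.2.2, Props. 1.2.5, 14, Cor. 1.2.6] [cite: KellerYin2024, Thms. 1.2.2, 2.2.2 (arXiv:2402.12781v2)]
[cite: MilneADT2006, I Thm. 4.10 (a)] [cite: JetchevSkinnerWan2017, §7.4.1] [cite: FriedbergHoffstein1995, Thm. B] -/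
theorem missingLowerBoundAt_gordTwo (hF : PrintedFacts)
    (hA : Hsieh2014.thmA_exists_isHsiehLFunction_unrPeriod_anyLevel)
    (hL : LiuZhangZhang2018.thm151_thm153_modularCurve_heegnerVector_additive)
    (hCHσ : castellaHsieh2018_exists_isBranchBDPLFunction_signed)
    (hDVD : thm336_dvd_branch_OPEN)
    (hAN3 : thm351_anacong_branch_three_allTwists) (hBR3 : thm122_charLambda_pair_three) (h212 : thm212_exists_isKatzLFunction)
    (hAN5 : thm351_anacong_charLambda_branch_five_le)
    (hprop125 : prop125_characterGrSelmerDual_torsion_muZero_dim) (hfact : prop14_residualCharacterSelmer_finite)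
    (hlift : cor126_residualCharacter_globalLift) (hlocal : cor126_residualCharacter_localSurjective)
    (hRH : thm122_rubinHida_residualPair_unrSelmer) (hPWL : prop125_residualPair_unrSelmer_imprimitive)
    (h331 : thm331_rubin_exists_katzMeasure₂_pseudoIso_span_eq)
    (hFE : thmII64_katzMeasure₂_functionalEquation) (hO1 : thmI_mu_katzBranch_reflect_eq_zero)
    (hPT : ∀ (L : Type) [Field L] [NumberField L] [IsTotallyComplex L] (S : Set (HeightOneSpectrum (𝓞 L))),
      S.Finite → Literature.NumberTheory.GaloisCohomology.poitouTate_shaRestricted_tateDual_natural_at L S) :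
    ∀ (W : WeierstrassCurve ℚ) [W.IsElliptic] [W.IsGloballyMinimal] (p : ℕ) [Fact p.Prime],
      W.analyticRank = 1 → p ≠ 2 → ClassX3 W p → Additive.SubGordTwo W p → MissingLowerBoundAt W p := by
  intro W _ _ p _ hr hp2 hX hG
  have hp : p.Prime := Fact.out
  obtain rfl | hp5 : p = 3 ∨ 5 ≤ p := by
    rcases Nat.lt_or_ge p 5 with h | h
    · left
      have h2 := hp.two_le
      interval_cases p
      · exact absurd rfl hp2
      · rfl
      · exact absurd hp (by norm_num)
    · exact Or.inr h
  · exact missingLowerBoundAt_gordTwo_three hF hA hL hCHσ hDVD hAN3.to_branch_three hAN3 hBR3 h212 hprop125 hfact hlift hlocal hRH hPWL h331 hFE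
      hO1 hPT W hr hX hG
  · exact missingLowerBoundAt_gordTwo_five_le hF hA hL hCHσ hDVD hAN5 hprop125 hfact hlift hlocal hPT W p hp5 hr hX hG

/-- **BOTH halves per pair on the WHOLE (G-ord, `e = 2`) half at EVERY odd prime from the TU datum: `MissingPPartAt W p`, Greenberg-free** — `p = 3`: §1; `p ≥ 5`:
§2.  CONDITIONAL; closes no item; BSD not advanced beyond this typed reduction. [claim: KellerYin2024PotOrd, status: under-review] [cite: Miller2011LMS, Def. 1.1]
[cite: KellerYin2024b, Thm. 3.3.6, Prop. 3.4.4, §3.5 (arXiv:2410.23241 pp. 19–20) (preprint; hypotheses)] -/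
theorem missingPPartAt_gordTwo_of_twistUnitAt (hF : PrintedFacts)
    (hA : Hsieh2014.thmA_exists_isHsiehLFunction_unrPeriod_anyLevel)
    (hL : LiuZhangZhang2018.thm151_thm153_modularCurve_heegnerVector_additive)
    (hCHσ : castellaHsieh2018_exists_isBranchBDPLFunction_signed)
    (hDVD : thm336_dvd_branch_OPEN)
    (hAN3 : thm351_anacong_branch_three_allTwists) (hBR3 : thm122_charLambda_pair_three) (h212 : thm212_exists_isKatzLFunction)
    (hAN5 : thm351_anacong_charLambda_branch_five_le)
    (hprop125 : prop125_characterGrSelmerDual_torsion_muZero_dim) (hfact : prop14_residualCharacterSelmer_finite)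
    (hlift : cor126_residualCharacter_globalLift) (hlocal : cor126_residualCharacter_localSurjective)
    (hRH : thm122_rubinHida_residualPair_unrSelmer) (hPWL : prop125_residualPair_unrSelmer_imprimitive)
    (h331 : thm331_rubin_exists_katzMeasure₂_pseudoIso_span_eq)
    (hFE : thmII64_katzMeasure₂_functionalEquation) (hO1 : thmI_mu_katzBranch_reflect_eq_zero)
    (hPT : ∀ (L : Type) [Field L] [NumberField L] [IsTotallyComplex L] (S : Set (HeightOneSpectrum (𝓞 L))),
      S.Finite → Literature.NumberTheory.GaloisCohomology.poitouTate_shaRestricted_tateDual_natural_at L S) :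
    ∀ (W : WeierstrassCurve ℚ) [W.IsElliptic] [W.IsGloballyMinimal] (p : ℕ) [Fact p.Prime],
      W.analyticRank = 1 → p ≠ 2 → ClassX3 W p → Additive.SubGordTwo W p → Upper.TwistUnitFieldOffSliverAt W p → MissingPPartAt W p := by
  intro W _ _ p _ hr hp2 hX hG hTU
  have hp : p.Prime := Fact.out
  obtain rfl | hp5 : p = 3 ∨ 5 ≤ p := by
    rcases Nat.lt_or_ge p 5 with h | h
    · left
      have h2 := hp.two_le
      interval_cases p
      · exact absurd rfl hp2
      · rfl
      · exact absurd hp (by norm_num)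
    · exact Or.inr h
  · exact missingPPartAt_gordTwo_three_of_twistUnitAt hF hA hL hCHσ hDVD hAN3.to_branch_three hAN3 hBR3 h212 hprop125 hfact hlift hlocal hRH
      hPWL h331 hFE hO1 hPT W hr hX hG hTU
  · exact missingPPartAt_gordTwo_five_le_of_twistUnitAt hF hA hL hCHσ hDVD hAN5 hprop125 hfact hlift hlocal hPT W p hp5 hr hX hG hTU

/-- **Miller's `BSD(E, p)` per pair on the WHOLE (G-ord, `e = 2`) half at EVERY odd prime from the TU datum, Greenberg-free** — the previous theorem through
`bsdp_of_missingPPartAt`.  NOT a proof of BSD for any curve: BSD_p MODULO {published theorems} ∪ {[DIV.dvd], the typed analytic sentences, [RH], [PWL-θ],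
Milne I 4.10 (a)} ∪ {the pair's TU certificate}. [claim: KellerYin2024PotOrd, status: under-review] [cite: Miller2011LMS, §1 and Def. 1.1]
[cite: KellerYin2024b, Thm. 3.3.6, Prop. 3.4.4, §3.5 (arXiv:2410.23241 pp. 19–20) (preprint; hypotheses)] -/
theorem bsdp_gordTwo_of_twistUnitAt (hF : PrintedFacts)
    (hA : Hsieh2014.thmA_exists_isHsiehLFunction_unrPeriod_anyLevel)
    (hL : LiuZhangZhang2018.thm151_thm153_modularCurve_heegnerVector_additive)
    (hCHσ : castellaHsieh2018_exists_isBranchBDPLFunction_signed)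
    (hDVD : thm336_dvd_branch_OPEN)
    (hAN3 : thm351_anacong_branch_three_allTwists) (hBR3 : thm122_charLambda_pair_three) (h212 : thm212_exists_isKatzLFunction)
    (hAN5 : thm351_anacong_charLambda_branch_five_le)
    (hprop125 : prop125_characterGrSelmerDual_torsion_muZero_dim) (hfact : prop14_residualCharacterSelmer_finite)
    (hlift : cor126_residualCharacter_globalLift) (hlocal : cor126_residualCharacter_localSurjective)
    (hRH : thm122_rubinHida_residualPair_unrSelmer) (hPWL : prop125_residualPair_unrSelmer_imprimitive)
    (h331 : thm331_rubin_exists_katzMeasure₂_pseudoIso_span_eq)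
    (hFE : thmII64_katzMeasure₂_functionalEquation) (hO1 : thmI_mu_katzBranch_reflect_eq_zero)
    (hPT : ∀ (L : Type) [Field L] [NumberField L] [IsTotallyComplex L] (S : Set (HeightOneSpectrum (𝓞 L))),
      S.Finite → Literature.NumberTheory.GaloisCohomology.poitouTate_shaRestricted_tateDual_natural_at L S) :
    ∀ (W : WeierstrassCurve ℚ) [W.IsElliptic] [W.IsGloballyMinimal] (p : ℕ) [Fact p.Prime],
      W.analyticRank = 1 → p ≠ 2 → ClassX3 W p → Additive.SubGordTwo W p → Upper.TwistUnitFieldOffSliverAt W p → BSDp W p :=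
  fun W _ _ p _ hr hp2 hX hG hTU =>
    bsdp_of_missingPPartAt W p hF.2.2.1 (le_of_eq hr)
      (missingPPartAt_gordTwo_of_twistUnitAt hF hA hL hCHσ hDVD hAN3 hBR3 h212 hAN5 hprop125 hfact hlift hlocal hRH hPWL h331 hFE hO1 hPT W p hr hp2
        hX hG hTU)

end Summit.BirchSwinnertonDyer.BirchSwinnertonDyer.Theorems.SchneiderFreeAdditiveX3.KYBranchPerPairOfPT

end
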